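import Mathlib
import Summits.NavierStokesRegularity.NavierStokesRegularity.Theses.RootDecompLeanestSingularity
import Summits.NavierStokesRegularity.NavierStokesRegularity.Theses.RootDecompEternalSpike
import Summits.NavierStokesRegularity.NavierStokesRegularity.Theses.RootDecompMorreyBudget
import Summits.NavierStokesRegularity.NavierStokesRegularity.Theorems.RootDecompLeanestSingularityThresholdOfPieces
import Summits.NavierStokesRegularity.NavierStokesRegularity.Theorems.L3TimeExponentPincerWeakL3Morrey
import Summits.NavierStokesRegularity.NavierStokesRegularity.Theorems.TypeICertificateLadderNoTypeIBlowupTypeIMorrey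
import Literature.Analysis.FluidPDE.LocalTypeI
import Literature.Analysis.FluidPDE.AlbrittonBarkerForwardHolds
import Literature.Analysis.FluidPDE.LiouvilleExcludesLocalTypeI

/-!
# THE MORREY MERGE — dominance edges of the decomp-ns forest, PROVED (lens-4 g18; critic row 171 CLEARED)

NL := `RootDecompMorreyBudget.NoLocalTypeISingularity` (stmt-10480 by name, the registered shared door of both
Morrey lines, itself ROUTED below (L) `LiouvilleConjectureNS`). This file lands the ROUTING theorems of the merge,
every edge typed on TREE decls:

* `morrey_of_envelope` — Lorentz ⊂ Morrey in the Bochner currency of N20's zoom theorem (weak-L³ envelope ⟹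
  uniform Morrey bound, via the landed `lintegral_ball_sq_le_of_weakL3`);
* `hasSmoothExtensionPast_of_morrey_of_NL` — Morrey ∧ NL ⟹ continuation past `T` (landed
  `isBackwardBoundedAt_of_morrey_of_not_localTypeISingularityExists` + the parabolic-cylinder continuation criterion);
* N 32146 `LeanEnvelopedIsTypeI` ⟸ NL; EZE 33669 `EnvelopedEternalExtraction` ⟸ NL; P1 1217 `NoTypeIBlowup` ⟸ NL;
* NMT 29108 `LeanThresholdIsTypeI` ⟸ Eᴹ 34238 `LeanTypeIIMorreyBounded` ∧ NL (the NEW door-glued sufficient pair)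
  and ⟸ E 32147 ∧ NL (E ⟹ Eᴹ); N28 BYPASSED: `LeanestSingularityConeRest` 33670 ∧ NL ⟹ Clay (A);
* necessity / placement: S ⟹ Eᴹ (vacuity), NL ⟺ ¬`NontrivialMildAncientTypeIExists` (A–B 2019 Thm 1.1 tree theorem),
  NL ⟸ (L), N20's M ∧ NL continue every tame blow-up.

Sources: Albritton–Barker 2019 (arXiv:1811.00502) Thm 1.1; Seregin 2007; KNSS 2009 (arXiv:0709.3599); lens file
HOME/decomp-ns-lens-4/MorreyMerge.lean (sha256 6498dc7f…), §2/§3/§5/§6 verbatim up to namespacing.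
-/

noncomputable section

set_option linter.dupNamespace false

open Set Function Filter Topology MeasureTheory Metric
open scoped NNReal ENNReal

namespace Summit.NavierStokesRegularity.NavierStokesRegularity.Theorems.RootDecompLeanestSingularityMorreyMerge

open Literature.Analysis.FluidPDE
open Summit.NavierStokesRegularity.NavierStokesRegularity.Theses.RootDecompLeanestSingularity
  (MarginalReduction LeanBadDatumExists LeanThresholdIsTypeI LeanEnvelopedIsTypeI LeanTypeIIEnveloped
   LeanThresholdIsTypeI_of_pieces NoTypeIBlowup)
open Summit.NavierStokesRegularity.NavierStokesRegularity.Theses.RootDecompMorreyBudget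
  (NoLocalTypeISingularity TameBlowupIsMorreyBounded)
open Summit.NavierStokesRegularity.NavierStokesRegularity.Theses.RootDecompEternalSpike
  (NoEternalSpikeProfile EnvelopedEternalExtraction LeanestSingularityConeRest)
open Summit.NavierStokesRegularity.NavierStokesRegularity.Theorems.L3TimeExponentPincerMorreyGrowth
  (V₁ V₁_nonneg)
open Summit.NavierStokesRegularity.NavierStokesRegularity.Theorems.L3TimeExponentPincerWeakL3Morrey
  (lintegral_ball_sq_le_of_weakL3)

variable {ν T : ℝ} {u : ℝ → EuclideanSpace ℝ (Fin 3) → EuclideanSpace ℝ (Fin 3)}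
  {p : ℝ → EuclideanSpace ℝ (Fin 3) → ℝ}

/-! ## §1 Engine: weak-L³ envelope ⟹ uniform Morrey bound; Morrey ∧ NL ⟹ continuation past T -/

/-- Lorentz ⊂ Morrey in the Bochner currency of the zoom theorem: a weak-L³ envelope on `[0,T)` of a
classical solution gives `∫_{B_r(x₁)} |u(t)|² ≤ (V₁ + 2M) r` for all `t ∈ (0,T)`, all centres, all
`0 < r ≤ 1` (landed `lintegral_ball_sq_le_of_weakL3`). -/
theorem morrey_of_envelope (hT : 0 < T) (hsol : IsClassicalNSSolutionOn (Ico 0 T) ν 0 u p)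
    (henv : ∃ M : ℝ≥0∞, M < ⊤ ∧ ∀ t : ℝ, 0 ≤ t → t < T → ∀ σ : ℝ, 0 < σ →
      ENNReal.ofReal σ ^ 3 * volume {x : EuclideanSpace ℝ (Fin 3) | σ < ‖u t x‖} ≤ M) :
    ∃ r₀ M₀ T₁ : ℝ, 0 < r₀ ∧ T₁ < T ∧ ∀ t ∈ Set.Ioo T₁ T,
      ∀ (x₁ : EuclideanSpace ℝ (Fin 3)) (r : ℝ), 0 < r → r ≤ r₀ →
        ∫ x in Metric.ball x₁ r, ‖u t x‖ ^ 2 ≤ M₀ * r := by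
  obtain ⟨M, hMtop, hM⟩ := henv
  set m : ℝ := M.toReal with hm
  have hm0 : 0 ≤ m := ENNReal.toReal_nonneg
  refine ⟨1, V₁ + 2 * m, 0, one_pos, hT, fun t ht x₁ r hr _ => ?_⟩
  have hcont : Continuous (u t) := (hsol.contDiff_velocity ⟨ht.1.le, ht.2⟩).continuous
  have hmeas : AEStronglyMeasurable (u t) volume := hcont.aestronglyMeasurable
  have hw : ∀ s : ℝ, 0 < s →
      ENNReal.ofReal s ^ 3 * volume {x : EuclideanSpace ℝ (Fin 3) | s < ‖u t x‖} ≤ ENNReal.ofReal m :=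
    fun s hs => (hM t ht.1.le ht.2 s hs).trans_eq (ENNReal.ofReal_toReal hMtop.ne).symm
  have hlin : ∫⁻ y in ball x₁ r, ‖u t y‖ₑ ^ 2 ≤ ENNReal.ofReal ((V₁ + 2 * m) * r) :=
    lintegral_ball_sq_le_of_weakL3 hmeas hm0 hw x₁ hr
  have hnn : 0 ≤ (V₁ + 2 * m) * r := by
    have := V₁_nonneg
    positivity
  have hfm : AEStronglyMeasurable (fun x => ‖u t x‖ ^ 2) (volume.restrict (ball x₁ r)) :=
    Continuous.aestronglyMeasurable (by fun_prop)
  have hnn' : 0 ≤ᵐ[volume.restrict (ball x₁ r)] fun x => ‖u t x‖ ^ 2 :=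
    Eventually.of_forall fun x => sq_nonneg _
  have hrepr : ∫ x in ball x₁ r, ‖u t x‖ ^ 2
      = (∫⁻ x in ball x₁ r, ‖u t x‖ₑ ^ 2).toReal := by
    rw [integral_eq_lintegral_of_nonneg_ae hnn' hfm]
    congr 1
    refine lintegral_congr fun x => ?_
    rw [ENNReal.ofReal_pow (norm_nonneg _), ofReal_norm]
  rw [hrepr]
  exact ENNReal.toReal_le_of_le_ofReal hnn hlin

/-- Morrey ∧ NL ⟹ continuation past `T` (the landed zoom theorem of N20 at every vertex, then the landed
continuation criterion): the mechanism of `Theorems.noTypeIBlowup_of_not_localTypeISingularityExists`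
with the Morrey bound as a HYPOTHESIS instead of derived from the Type-I rate. -/
theorem hasSmoothExtensionPast_of_morrey_of_NL (hNL : ¬ LocalTypeISingularityExists)
    (hν : 0 < ν) (hT : 0 < T) (hsol : IsClassicalNSSolutionOn (Ico 0 T) ν 0 u p)
    (hLH : IsLerayHopfOn T ν 0 (u 0) u) (hdec : HasRapidSpatialDecay (u 0))
    (hMor : ∃ r₀ M₀ T₁ : ℝ, 0 < r₀ ∧ T₁ < T ∧ ∀ t ∈ Set.Ioo T₁ T,
      ∀ (x₁ : EuclideanSpace ℝ (Fin 3)) (r : ℝ), 0 < r → r ≤ r₀ →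
        ∫ x in Metric.ball x₁ r, ‖u t x‖ ^ 2 ≤ M₀ * r) :
    HasSmoothExtensionPast ν 0 u T := by
  obtain ⟨r₀, M₀, T₁, hr₀, hT₁, hM⟩ := hMor
  refine hasSmoothExtensionPast_of_forall_exists_parabolicCylinder hν hT hsol hLH hdec fun x₀ => ?_
  obtain ⟨r, hr, K, hK⟩ :=
    Summit.NavierStokesRegularity.NavierStokesRegularity.Theorems.isBackwardBoundedAt_of_morrey_of_not_localTypeISingularityExists
      hNL hν hT hsol hLH hr₀ hT₁ hM x₀
  refine ⟨r, hr, ?_⟩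
  rw [eLpNorm_exponent_top]
  refine eLpNormEssSup_lt_top_of_ae_bound (C := K) ?_
  refine (ae_restrict_mem (measurableSet_Ioo.prod measurableSet_ball)).mono ?_
  rintro ⟨t, x⟩ hz
  exact hK t hz.1 x hz.2

/-- **No enveloped first blow-up under NL**: a maximal smooth Leray–Hopf solution from a rapidly
decaying datum with a weak-L³ envelope on `[0,T)` cannot have lifespan `T` if no local Type-I singular
point exists. -/
theorem false_of_envelope_of_NL (hNL : ¬ LocalTypeISingularityExists) (hν : 0 < ν) (hT : 0 < T)
    (hmax : IsMaximalSmoothSolution ν 0 u p T) (hLH : IsLerayHopfOn T ν 0 (u 0) u)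
    (hdec : HasRapidSpatialDecay (u 0))
    (henv : ∃ M : ℝ≥0∞, M < ⊤ ∧ ∀ t : ℝ, 0 ≤ t → t < T → ∀ σ : ℝ, 0 < σ →
      ENNReal.ofReal σ ^ 3 * volume {x : EuclideanSpace ℝ (Fin 3) | σ < ‖u t x‖} ≤ M) : False :=
  hmax.2 (hasSmoothExtensionPast_of_morrey_of_NL hNL hν hT hmax.1 hLH hdec
    (morrey_of_envelope hT hmax.1 henv))

/-! ## §2 The routing theorems: N ⟸ NL, EZE ⟸ NL, P1 ⟸ NL, N28 bypassed -/

/-- **ROUTING: N ⟸ NL.**  N14's layer-2 item N = `LeanEnvelopedIsTypeI` (stmt-32146) follows from the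
shared core NL (stmt-10480) — vacuously: under NL there is no enveloped first blow-up at all (leanness,
marginality and `ε` unused; `ε := 1`). -/
theorem leanEnvelopedIsTypeI_of_noLocalTypeISingularity (hNL : NoLocalTypeISingularity) :
    LeanEnvelopedIsTypeI :=
  ⟨1, one_pos, fun _ _ hν hT _ _ hmax hLH hdec _ _ henv =>
    (false_of_envelope_of_NL hNL hν hT hmax hLH hdec henv).elim⟩

/-- **EZE ⟸ NL** (N28's attacked item 33669, vacuity under NL). -/
theorem eze_of_noLocalTypeISingularity (hNL : NoLocalTypeISingularity) : EnvelopedEternalExtraction :=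
  fun _ _ hν hT _ _ hmax hLH hdec henv _ =>
    (false_of_envelope_of_NL hNL hν hT hmax hLH hdec henv).elim

/-- P1 (N14's `NoTypeIBlowup`, stmt-1217) ⟸ NL — the landed theorem, re-typed on N14's decl. -/
theorem noTypeIBlowup_of_noLocalTypeISingularity (hNL : NoLocalTypeISingularity) : NoTypeIBlowup :=
  Summit.NavierStokesRegularity.NavierStokesRegularity.Theorems.noTypeIBlowup_of_not_localTypeISingularityExists
    hNL

/-- **N28 BYPASSED**: N28's deciding theorem needs neither EZE nor NEP once NL is granted —
`Rest(33670) ∧ NL ⟹ Clay (A)` through N14's born `closes` BY NAME. -/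
theorem closes_N28_bypass (hK : LeanestSingularityConeRest) (hNL : NoLocalTypeISingularity) :
    _root_.NavierStokesRegularity :=
  Summit.NavierStokesRegularity.NavierStokesRegularity.Theses.RootDecompLeanestSingularity.closes
    hK.1 hK.2.1 (hK.2.2.2.1 (leanEnvelopedIsTypeI_of_noLocalTypeISingularity hNL) hK.2.2.1) hK.2.2.2.2

/-- N28's own `closes` fed by the routing (agreement check: EZE and NEP both come from NL). -/
theorem closes_N28_via_NL (hK : LeanestSingularityConeRest) (hNL : NoLocalTypeISingularity)
    (hN : NoEternalSpikeProfile) : _root_.NavierStokesRegularity :=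
  Summit.NavierStokesRegularity.NavierStokesRegularity.Theses.RootDecompEternalSpike.closes hK
    (eze_of_noLocalTypeISingularity hNL) hN

/-! Eᴹ = item stmt-34238 `RootDecompLeanestSingularity.LeanTypeIIMorreyBounded` is written INLINE below (its ledger
signature verbatim, names opened), so every Eᴹ-edge here is definitionally the edge on the born decl. -/

/-! ## §3 The merged cut of lens 4's line: NMT ⟸ Eᴹ ∧ NL; S ⟸ R ∧ X ∧ Eᴹ ∧ NL -/

/-- E ⟹ Eᴹ (the booked residual E 32147 is STRONGER: its weak-L³ envelope is a Morrey bound). -/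
theorem leanTypeIIMorreyBounded_of_E (hE : LeanTypeIIEnveloped) :
    (∃ ε : ℝ, 0 < ε ∧ ∀ (ν T : ℝ), 0 < ν → 0 < T →
      ∀ (u : ℝ → EuclideanSpace ℝ (Fin 3) → EuclideanSpace ℝ (Fin 3)) (p : ℝ → EuclideanSpace ℝ (Fin 3) → ℝ),
        IsMaximalSmoothSolution ν 0 u p T → IsLerayHopfOn T ν 0 (u 0) u → HasRapidSpatialDecay (u 0) →
        (∀ ν' : ℝ, ν < ν' → HasGlobalKatoSolution ν' (u 0)) →
        (∀ v : EuclideanSpace ℝ (Fin 3) → EuclideanSpace ℝ (Fin 3),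
          (ContDiff ℝ (⊤ : ℕ∞) v ∧ NSWave0.IsDivFree v ∧ HasRapidSpatialDecay v) → ¬ HasGlobalKatoSolution ν v →
            eLpNorm (u 0) 3 volume ≤ ENNReal.ofReal (1 + ε) * eLpNorm v 3 volume) →
        ¬ IsTypeIBlowup u T →
          ∃ r₀ M₀ T₁ : ℝ, 0 < r₀ ∧ T₁ < T ∧ ∀ t ∈ Set.Ioo T₁ T,
            ∀ (x₁ : EuclideanSpace ℝ (Fin 3)) (r : ℝ), 0 < r → r ≤ r₀ →
              ∫ x in Metric.ball x₁ r, ‖u t x‖ ^ 2 ≤ M₀ * r) := by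
  obtain ⟨ε, hε, hE⟩ := hE
  refine ⟨ε, hε, fun ν T hν hT u p hmax hLH hdec hmarg hlean hII => ?_⟩
  exact morrey_of_envelope hT hmax.1 (hE ν T hν hT u p hmax hLH hdec hmarg hlean hII)

/-- **New glue: NMT(29108) ⟸ Eᴹ(34238) ∧ NL(10480).**  A lean marginal blow-up is Type I: if not, Eᴹ makes it
Morrey-bounded and NL continues it past `T`, contradicting maximality. -/
theorem leanThresholdIsTypeI_of_EM_NL
    (hE : (∃ ε : ℝ, 0 < ε ∧ ∀ (ν T : ℝ), 0 < ν → 0 < T →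
      ∀ (u : ℝ → EuclideanSpace ℝ (Fin 3) → EuclideanSpace ℝ (Fin 3)) (p : ℝ → EuclideanSpace ℝ (Fin 3) → ℝ),
        IsMaximalSmoothSolution ν 0 u p T → IsLerayHopfOn T ν 0 (u 0) u → HasRapidSpatialDecay (u 0) →
        (∀ ν' : ℝ, ν < ν' → HasGlobalKatoSolution ν' (u 0)) →
        (∀ v : EuclideanSpace ℝ (Fin 3) → EuclideanSpace ℝ (Fin 3),
          (ContDiff ℝ (⊤ : ℕ∞) v ∧ NSWave0.IsDivFree v ∧ HasRapidSpatialDecay v) → ¬ HasGlobalKatoSolution ν v →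
            eLpNorm (u 0) 3 volume ≤ ENNReal.ofReal (1 + ε) * eLpNorm v 3 volume) →
        ¬ IsTypeIBlowup u T →
          ∃ r₀ M₀ T₁ : ℝ, 0 < r₀ ∧ T₁ < T ∧ ∀ t ∈ Set.Ioo T₁ T,
            ∀ (x₁ : EuclideanSpace ℝ (Fin 3)) (r : ℝ), 0 < r → r ≤ r₀ →
              ∫ x in Metric.ball x₁ r, ‖u t x‖ ^ 2 ≤ M₀ * r))
    (hNL : NoLocalTypeISingularity) : LeanThresholdIsTypeI := by
  obtain ⟨ε, hε, hE⟩ := hE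
  refine ⟨ε, hε, fun ν T hν hT u p hmax hLH hdec hmarg hlean => ?_⟩
  by_contra hII
  exact hmax.2 (hasSmoothExtensionPast_of_morrey_of_NL hNL hν hT hmax.1 hLH hdec
    (hE ν T hν hT u p hmax hLH hdec hmarg hlean hII))

/-- NMT ⟸ E ∧ NL (the booked residual E in place of Eᴹ). -/
theorem leanThresholdIsTypeI_of_E_NL (hE : LeanTypeIIEnveloped) (hNL : NoLocalTypeISingularity) :
    LeanThresholdIsTypeI :=
  leanThresholdIsTypeI_of_EM_NL (leanTypeIIMorreyBounded_of_E hE) hNL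

/-- **DECIDING THEOREM of the merged node** — FOUR binders, all consumed, through N14's born `closes`
BY NAME: R(25947) ∧ X(29109) ∧ Eᴹ(34238) ∧ NL(10480) ⟹ Clay (A). -/
theorem closes_merged (hR : MarginalReduction) (hX : LeanBadDatumExists)
    (hEM : (∃ ε : ℝ, 0 < ε ∧ ∀ (ν T : ℝ), 0 < ν → 0 < T →
      ∀ (u : ℝ → EuclideanSpace ℝ (Fin 3) → EuclideanSpace ℝ (Fin 3)) (p : ℝ → EuclideanSpace ℝ (Fin 3) → ℝ),
        IsMaximalSmoothSolution ν 0 u p T → IsLerayHopfOn T ν 0 (u 0) u → HasRapidSpatialDecay (u 0) →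
        (∀ ν' : ℝ, ν < ν' → HasGlobalKatoSolution ν' (u 0)) →
        (∀ v : EuclideanSpace ℝ (Fin 3) → EuclideanSpace ℝ (Fin 3),
          (ContDiff ℝ (⊤ : ℕ∞) v ∧ NSWave0.IsDivFree v ∧ HasRapidSpatialDecay v) → ¬ HasGlobalKatoSolution ν v →
            eLpNorm (u 0) 3 volume ≤ ENNReal.ofReal (1 + ε) * eLpNorm v 3 volume) →
        ¬ IsTypeIBlowup u T →
          ∃ r₀ M₀ T₁ : ℝ, 0 < r₀ ∧ T₁ < T ∧ ∀ t ∈ Set.Ioo T₁ T,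
            ∀ (x₁ : EuclideanSpace ℝ (Fin 3)) (r : ℝ), 0 < r → r ≤ r₀ →
              ∫ x in Metric.ball x₁ r, ‖u t x‖ ^ 2 ≤ M₀ * r))
    (hNL : NoLocalTypeISingularity) : _root_.NavierStokesRegularity :=
  Summit.NavierStokesRegularity.NavierStokesRegularity.Theses.RootDecompLeanestSingularity.closes hR hX
    (leanThresholdIsTypeI_of_EM_NL hEM hNL) (noTypeIBlowup_of_noLocalTypeISingularity hNL)

/-- The same node with the booked E in place of Eᴹ (E is the stronger sibling). -/
theorem closes_merged_with_E (hR : MarginalReduction) (hX : LeanBadDatumExists) (hE : LeanTypeIIEnveloped)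
    (hNL : NoLocalTypeISingularity) : _root_.NavierStokesRegularity :=
  closes_merged hR hX (leanTypeIIMorreyBounded_of_E hE) hNL

/-! ## §4 Necessity and placement certificates -/

/-- Under S there is no maximal smooth Leray–Hopf blow-up from a rapidly decaying datum (N14 currency). -/
theorem false_of_root_of_isMaximalSmoothSolution (hA : _root_.NavierStokesRegularity)
    (hν : 0 < ν) (hT : 0 < T) (hmax : IsMaximalSmoothSolution ν 0 u p T)
    (hLH : IsLerayHopfOn T ν 0 (u 0) u) (hdec : HasRapidSpatialDecay (u 0)) : False :=
  Literature.NS.blowup_assembly ⟨⟨ν, hν, T, hT, u, p, hmax, hLH, hdec⟩,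
    not_not.1 Summit.NavierStokesRegularity.NavierStokesRegularity.Theorems.BlowupBlowupClayNonuniqueness_refuted⟩ hA

/-- S ⟹ Eᴹ (vacuity): Eᴹ is WEAKER than the summit. -/
theorem leanTypeIIMorreyBounded_of_root (hA : _root_.NavierStokesRegularity) :
    (∃ ε : ℝ, 0 < ε ∧ ∀ (ν T : ℝ), 0 < ν → 0 < T →
      ∀ (u : ℝ → EuclideanSpace ℝ (Fin 3) → EuclideanSpace ℝ (Fin 3)) (p : ℝ → EuclideanSpace ℝ (Fin 3) → ℝ),
        IsMaximalSmoothSolution ν 0 u p T → IsLerayHopfOn T ν 0 (u 0) u → HasRapidSpatialDecay (u 0) →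
        (∀ ν' : ℝ, ν < ν' → HasGlobalKatoSolution ν' (u 0)) →
        (∀ v : EuclideanSpace ℝ (Fin 3) → EuclideanSpace ℝ (Fin 3),
          (ContDiff ℝ (⊤ : ℕ∞) v ∧ NSWave0.IsDivFree v ∧ HasRapidSpatialDecay v) → ¬ HasGlobalKatoSolution ν v →
            eLpNorm (u 0) 3 volume ≤ ENNReal.ofReal (1 + ε) * eLpNorm v 3 volume) →
        ¬ IsTypeIBlowup u T →
          ∃ r₀ M₀ T₁ : ℝ, 0 < r₀ ∧ T₁ < T ∧ ∀ t ∈ Set.Ioo T₁ T,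
            ∀ (x₁ : EuclideanSpace ℝ (Fin 3)) (r : ℝ), 0 < r → r ≤ r₀ →
              ∫ x in Metric.ball x₁ r, ‖u t x‖ ^ 2 ≤ M₀ * r) :=
  ⟨1, one_pos, fun _ _ hν hT _ _ hmax hLH hdec _ _ _ =>
    (false_of_root_of_isMaximalSmoothSolution hA hν hT hmax hLH hdec).elim⟩

/-- NL is, by name, the negation of the tree's registered open statement (dedup with 10480). -/
theorem nl_iff_lit : NoLocalTypeISingularity ↔ ¬ LocalTypeISingularityExists := Iff.rfl

/-- NL ⟺ «no non-trivial mild bounded ancient solution with 𝐈 < ∞» (tree THEOREM, A–B 2019 Thm 1.1). -/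
theorem nl_iff_noAncientTypeI : NoLocalTypeISingularity ↔ ¬ NontrivialMildAncientTypeIExists :=
  not_congr AlbrittonBarkerTypeICharacterization_holds

/-- NL ⟸ (L) (landed; the door is ROUTED to the Liouville programme). -/
theorem nl_of_liouvilleConjectureNS
    (hL : Summit.NavierStokesRegularity.NavierStokesRegularity.LiouvilleConjectureNS) :
    NoLocalTypeISingularity :=
  not_localTypeISingularityExists_of_liouvilleConjectureNS hL

/-- The glue item 32148 of N14 is CLOSED in the tree (p776059); named here for the record. -/
theorem glue_32148_inTree : LeanThresholdIsTypeI_of_pieces :=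
  Summit.NavierStokesRegularity.NavierStokesRegularity.Theorems.rootDecompLeanestSingularity_leanThresholdIsTypeI_of_pieces_proof

/-- Both Morrey cells close the summit the same way: N20's M ∧ NL continue every TAME first blow-up. -/
theorem tame_continues_of_M_NL (hM : TameBlowupIsMorreyBounded) (hNL : NoLocalTypeISingularity)
    (hν : 0 < ν) (hT : 0 < T) (hmax : IsMaximalSmoothSolution ν 0 u p T)
    (hLH : IsLerayHopfOn T ν 0 (u 0) u) (hdec : HasRapidSpatialDecay (u 0))
    (htame : Filter.Tendsto (fun t => eLpNorm (u t - u T) 2 volume) (nhdsWithin T (Set.Iio T)) (nhds 0)) :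
    False :=
  hmax.2 (hasSmoothExtensionPast_of_morrey_of_NL hNL hν hT hmax.1 hLH hdec
    (hM ν T hν hT u p hmax hLH hdec htame))

end Summit.NavierStokesRegularity.NavierStokesRegularity.Theorems.RootDecompLeanestSingularityMorreyMerge

end
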